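import Summits.AtomisticToContinuum.Crystallization.Theorems.ThreeConeCertificateSlackRigidityPricedFloorsIncrements
import Summits.AtomisticToContinuum.Crystallization.Theorems.ThreeConeCertificateSlackRigidityPricedFloorsIncrIdent4
import Summits.AtomisticToContinuum.Crystallization.Theorems.ThreeConeCertificateSlackRigidityPricedFloorsIncrIdent5
import Summits.AtomisticToContinuum.Crystallization.Theorems.ThreeConeCertificateSlackRigidityPricedFloorsKernels1
import Summits.AtomisticToContinuum.Crystallization.Theorems.ThreeConeCertificateSlackRigidityPricedFloorsUnique3
import Summits.AtomisticToContinuum.Crystallization.Theorems.ThreeConeCertificateSlackRigidityPricedFloorsFinal0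
import HarnessLib

/-!
# `SlackRigidity` (stmt-AtomisticToContinuum-11960), line `priced-floors-palm-exactification`, stub S3
# (`stub_layeredMeanSelection`): final assembly, part 2 — almost surely all layer spacings are equal

Lead c19.  We instantiate the abstract mean increment argument
`SlackRigidityPricedFloorsProb.lms_increments_ae_zero'` with the landed geometric ingredients:
the measurable increment functionals `D, A, B, V, Dt` of the sample
(`lms_exists_increment_functionals`), the uniform and the symmetrised shifted layer-transport kernels
(`lms_exists_kernels` with the weights of `lms_uniformCoeff_props` / `shiftCoeff_props`), the
identifications `lms_ident_A / lms_ident_B / lms_ident_D` of the transported integrands (and their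
trivial counterparts on ideal fcc samples, where the transport is `1[y = 0]`), the convexity instance
`lms_convexity_instance` (which needs the almost sure absence of stacking faults, our hypothesis) and
the edge bound `lms_Dt_le`.  This gives `D = (Δ₀ − Δ₁)² + (Δ₋₂ − Δ₋₁)² = 0` almost surely at the root;
the root-to-everywhere transfer `PalmUnimodularRigidity.ae_forall_map_sub_of_ae` evaluated at the
pattern points of every layer (`lms_D_map_sub_pointOf`) then forces all consecutive layer spacings to
agree, i.e. `z m = m · z 1` (registered sub-goal `lms_ae_equal_spacing`).  All `[folklore]`.
-/

noncomputable section

open MeasureTheory Filter Set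
open scoped ENNReal BigOperators Topology

namespace Summit.AtomisticToContinuum.Crystallization.Theorems.SlackRigidityPricedFloorsFinal

open Literature.Probability.Process
open Literature.MathematicalPhysics.StatisticalMechanics
open Summit.AtomisticToContinuum.Crystallization.Theorems.SlackRigidityPricedFloors
open Summit.AtomisticToContinuum.Crystallization.Theorems.SlackRigidityPricedFloorsIncrIdent
open Summit.AtomisticToContinuum.Crystallization.Theorems.SlackRigidityPricedFloorsKernels
open Summit.AtomisticToContinuum.Crystallization.Theorems.SlackRigidityPricedFloorsUnique
open Summit.AtomisticToContinuum.Crystallization.Theorems.SlackRigidityPricedFloorsProb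
open Summit.AtomisticToContinuum.Crystallization.Theorems.MinimiserShells.Negative.LoadBearing (eStar)
open Summit.AtomisticToContinuum.Crystallization.Theorems.PalmUnimodularRigidityMinimiserShells.EnergyFloor
  (rootEnergy' rootEnergy'_eq_of_hc rootEnergy'_bounds_of_hc)

/-! ## Generic evaluation of transported integrands on a sample -/

/-- Integration against the trivial transport `1[y = 0]` over a rooted sample evaluates at the root.
[folklore] -/
theorem incr_lintegral_rootWeight {S : Set E3} (h0 : (0 : E3) ∈ S) {Ω : E3 → ℝ≥0∞} (hΩ0 : Ω 0 = 1)
    (hΩne : ∀ y, y ≠ 0 → Ω y = 0) (F : E3 → ℝ≥0∞) :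
    ∫⁻ y, Ω y * F y ∂((Measure.count : Measure E3).restrict S) = F 0 := by
  have h1 : (fun y : E3 => Ω y * F y) = ({(0 : E3)} : Set E3).indicator F := by
    funext y
    by_cases hy : y = 0
    · subst hy
      simp [hΩ0]
    · rw [hΩne y hy, zero_mul, Set.indicator_of_notMem (fun h : y ∈ ({0} : Set E3) => hy h)]
  rw [h1, lintegral_indicator (measurableSet_singleton 0), lintegral_singleton,
    Measure.restrict_apply (measurableSet_singleton 0),
    Set.inter_eq_left.2 (Set.singleton_subset_iff.2 h0), Measure.count_singleton, mul_one]

/-- **Transported integrand on an ideal fcc sample**: with the trivial transport, the integral is the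
value at the unshifted sample. [folklore] -/
theorem incr_transport_ident_fcc {S : Set E3} (h0 : (0 : E3) ∈ S) {Ω : E3 → ℝ≥0∞} (hΩ0 : Ω 0 = 1)
    (hΩne : ∀ y, y ≠ 0 → Ω y = 0) (G : Measure E3 → ℝ) {K L : ℝ}
    (hGL : G ((Measure.count : Measure E3).restrict S) = L) :
    ∫⁻ y, Ω y * ENNReal.ofReal (G (((Measure.count : Measure E3).restrict S).map (fun z => z - y)) + K)
      ∂((Measure.count : Measure E3).restrict S) = ENNReal.ofReal (L + K) := by
  rw [incr_lintegral_rootWeight h0 hΩ0 hΩne]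
  simp only [sub_zero, Measure.map_id', hGL]

/-- **Transported integrand against an explicit layer transport**: if the sent weight is `ofReal ∘ w`,
the functional `G` takes the value `v m` at the sample re-rooted at any point of layer `m`, `v + K ≥ 0`,
and nonnegative layerwise-constant test functions integrate against `w` to `L + K`, then the
transported integrand of `G + K` integrates to `L + K`. [folklore] -/
theorem incr_transport_ident_of_formula {S : Set E3} {e : LData} {Ω : E3 → ℝ≥0∞} {w : E3 → ℝ}
    (hΩ : ∀ y, Ω y = ENNReal.ofReal (w y)) (G : Measure E3 → ℝ) (v : ℤ → ℝ) {K L : ℝ}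
    (hGv : ∀ m i j : ℤ,
      G (((Measure.count : Measure E3).restrict S).map (fun z => z - pointOf e m i j)) = v m)
    (hv : ∀ m, 0 ≤ v m + K)
    (hident : ∀ g : E3 → ℝ, (∀ y, 0 ≤ g y) → (∀ m i j : ℤ, g (pointOf e m i j) = v m + K) →
      ∫⁻ y, ENNReal.ofReal (w y) * ENNReal.ofReal (g y) ∂((Measure.count : Measure E3).restrict S) =
        ENNReal.ofReal (L + K)) :
    ∫⁻ y, Ω y * ENNReal.ofReal (G (((Measure.count : Measure E3).restrict S).map (fun z => z - y)) + K)
      ∂((Measure.count : Measure E3).restrict S) = ENNReal.ofReal (L + K) := by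
  have hmax : ∀ x : ℝ, ENNReal.ofReal (max x 0) = ENNReal.ofReal x := fun x => by
    rcases le_total x 0 with h | h
    · rw [max_eq_right h, ENNReal.ofReal_zero, ENNReal.ofReal_of_nonpos h]
    · rw [max_eq_left h]
  have h := hident
    (fun y => max (G (((Measure.count : Measure E3).restrict S).map (fun z => z - y)) + K) 0)
    (fun y => le_max_right _ _) (fun m i j => by rw [hGv m i j, max_eq_left (hv m)])
  simp only [hmax] at h
  simpa only [hΩ] using h

/-! ## Arithmetic -/

/-- Vanishing of all symmetric jumps forces an arithmetic progression of heights. [folklore] -/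
theorem incr_heights_linear {z : ℤ → ℝ} (hz0 : z 0 = 0)
    (h : ∀ m : ℤ, ((z (m + 1) - z m) - (z (m + 2) - z (m + 1))) ^ 2 +
      ((z (m - 1) - z (m - 2)) - (z m - z (m - 1))) ^ 2 = 0) :
    ∀ m : ℤ, z m = m * z 1 := by
  have hstep : ∀ m : ℤ, z (m + 2) - z (m + 1) = z (m + 1) - z m := fun m => by
    have ha := sq_nonneg ((z (m + 1) - z m) - (z (m + 2) - z (m + 1)))
    have hb := sq_nonneg ((z (m - 1) - z (m - 2)) - (z m - z (m - 1)))
    have h2 : ((z (m + 1) - z m) - (z (m + 2) - z (m + 1))) ^ 2 = 0 := by linarith [h m]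
    have h3 := pow_eq_zero_iff (n := 2) (by norm_num) |>.1 h2
    linarith
  have hdiff : ∀ m : ℤ, z (m + 1) - z m = z 1 := by
    intro m
    induction m using Int.induction_on with
    | zero => simp [hz0]
    | succ k ih =>
      have h1 := hstep (k : ℤ)
      rw [show (k : ℤ) + 1 + 1 = (k : ℤ) + 2 by ring]
      linarith
    | pred k ih =>
      have h1 := hstep (-(k : ℤ) - 1)
      rw [show -(k : ℤ) - 1 + 2 = -(k : ℤ) + 1 by ring, show -(k : ℤ) - 1 + 1 = -(k : ℤ) by ring] at h1
      rw [show -(k : ℤ) - 1 + 1 = -(k : ℤ) by ring]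
      linarith
  intro m
  induction m using Int.induction_on with
  | zero => simp [hz0]
  | succ k ih =>
    have h1 := hdiff (k : ℤ)
    push_cast at ih ⊢
    linarith
  | pred k ih =>
    have h1 := hdiff (-(k : ℤ) - 1)
    rw [show -(k : ℤ) - 1 + 1 = -(k : ℤ) by ring] at h1
    push_cast at ih ⊢
    linarith

/-- From the convexity instance to the a.e. convexity inequality (larger constant). [folklore] -/
theorem incr_convexity_mono {κ Cc C x A : ℝ} (hC : Cc ≤ C) (n : ℕ)
    (h : 4 * eStar - Cc / (2 * (n : ℝ) + 1) + κ * x ≤ A) :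
    4 * eStar - C / (2 * (n : ℝ) + 1) + κ * x ≤ A := by
  have : Cc / (2 * (n : ℝ) + 1) ≤ C / (2 * (n : ℝ) + 1) :=
    div_le_div_of_nonneg_right hC (by positivity)
  linarith

/-- The doubled root energy of a rooted `δ`-hard-core sample is bounded by the hard-core constant.
[folklore] -/
theorem incr_abs_two_mul_rootEnergy_le {δ : ℝ} (hδ : 0 < δ) {μ : Measure E3} (hμ : IsRootedHardCore δ μ) :
    |2 * rootEnergy lennardJones μ| ≤ 2 * (250 / 12 * δ⁻¹ ^ 6 + 250 / 24 * δ⁻¹ ^ 12) := by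
  obtain ⟨h1, h2⟩ := rootEnergy'_bounds_of_hc hδ hμ
  have h3 : rootEnergy lennardJones μ = rootEnergy' μ := by
    rw [rootEnergy'_eq_of_hc hδ hμ, rootEnergy_def]
  rw [h3, abs_le]
  constructor <;> nlinarith [h1, h2, show (0 : ℝ) ≤ δ⁻¹ ^ 6 by positivity,
    show (0 : ℝ) ≤ δ⁻¹ ^ 12 by positivity]

/-! ## The registered sub-goal -/

/-- **Almost surely all layer spacings are equal** (registered sub-goal `lms_ae_equal_spacing`): under a
minimising law almost surely carried by globally layered, fault-free samples, almost every sample's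
layer heights are `z m = m · z 1` for every normal-form datum fitting it.  Proof: the mean increment
argument `lms_increments_ae_zero'` instantiated with the increment functionals, the two layer
transports and their identifications gives `D = 0` a.s.; root-to-everywhere and `incr_heights_linear`
conclude. [folklore] -/
theorem lms_ae_equal_spacing : ∀ (δ : ℝ), 0 < δ → ∀ (P : Measure (Measure E3)), IsProbabilityMeasure P → IsMinimisingLaw δ P → (∀ᵐ μ ∂P, GlobalLayered (atoms μ)) → (∀ᵐ μ ∂P, ∀ (S : Set E3) (e : LData), μ = (Measure.count : Measure E3).restrict S → (0 : E3) ∈ S → (∀ x ∈ S, ∀ y ∈ S, x ≠ y → δ ≤ dist x y) → Fits S e → ∀ m : ℤ, e.2.2.1 (m + 1) = -e.2.2.1 m) → ∀ᵐ μ ∂P, ∀ (S : Set E3) (e : LData), μ = (Measure.count : Measure E3).restrict S → (0 : E3) ∈ S → (∀ x ∈ S, ∀ y ∈ S, x ≠ y → δ ≤ dist x y) → Fits S e → ∀ m : ℤ, e.2.2.2 m = m * e.2.2.2 1 := by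
  intro δ hδ P hP hlaw hGL hFF
  obtain ⟨K₀, hK₀, D, hDm, hDb, hDid, hF⟩ := lms_exists_increment_functionals δ hδ lms_rel_of_fits
  have hcore := hlaw.1
  have hfit := lms_ae_fitted δ P hcore hGL
  obtain ⟨K₁, hK₁, hAB⟩ := lms_AB_bounds
  obtain ⟨κ, Cc, hκ, hCc, hconv⟩ := lms_convexity_instance
  set K : ℝ := max (max K₀ K₁) (2 * (250 / 12 * δ⁻¹ ^ 6 + 250 / 24 * δ⁻¹ ^ 12)) with hKdef
  have hK₀K : K₀ ≤ K := (le_max_left _ _).trans (le_max_left _ _)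
  have hK₁K : K₁ ≤ K := (le_max_right _ _).trans (le_max_left _ _)
  have hKpos : 0 ≤ K := hK₀.trans hK₀K
  -- Step 1: the symmetric jump functional vanishes almost surely (mean increment argument)
  have hD0 : ∀ᵐ μ ∂P, D μ = 0 := by
    refine lms_increments_ae_zero' δ hδ P hP hlaw D hDm K κ (max Cc 1) hκ
      (hCc.trans (le_max_left _ _))
      (Eventually.of_forall fun μ => ⟨(hDb μ).1, (hDb μ).2.trans hK₀K⟩) ?_ fun n => ?_
    · filter_upwards [hcore] with μ hμ using
        (incr_abs_two_mul_rootEnergy_le hδ hμ).trans (le_max_right _ _)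
    obtain ⟨A, B, V, Dt, hAm, hBm, hVm, hDtm, hAb, hBb, hVb, hDtb, hid⟩ := hF n
    -- the uniform and the symmetrised shifted layer transports
    obtain ⟨Ωr, Ωs, hΩrm, -, hker⟩ := lms_exists_kernels δ hδ n _ (lms_uniformCoeff_props n).1
      (lms_uniformCoeff_props n).2.1 (lms_uniformCoeff_props n).2.2.1
      (lms_uniformCoeff_props n).2.2.2.1 lms_layerRigid_of_not_fcc
    obtain ⟨Ωr', Ωs', hΩrm', -, hker'⟩ := lms_exists_kernels δ hδ (n + 1) _ (shiftCoeff_props n).1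
      (shiftCoeff_props n).2.1 (shiftCoeff_props n).2.2.1 (shiftCoeff_props n).2.2.2
      lms_layerRigid_of_not_fcc
    -- the uniform kernel weights are the averaged target indicators of `lms_ident_A / lms_ident_D`
    have hw : ∀ (e : LData) (y : E3), (∑ m ∈ Finset.Icc (-(n : ℤ)) n,
        (if m ∈ Finset.Icc (-(n : ℤ)) n then (1 : ℝ) / (2 * n + 1) else 0) *
          (if y ∈ layerTargets e m then (1 : ℝ) / (layerTargets e m).card else 0)) =
        (1 / (2 * (n : ℝ) + 1)) * ∑ m ∈ Finset.Icc (-(n : ℤ)) n,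
          (if y ∈ layerTargets e m then (1 : ℝ) / (layerTargets e m).card else 0) :=
      fun e y => (lms_uniformCoeff_props n).2.2.2.2 _
    refine ⟨A, B, V, Dt, Ωr, Ωs, Ωr', Ωs', hAm, hBm, hVm, hDtm,
      Eventually.of_forall fun μ => (hAb μ).trans hK₀K,
      Eventually.of_forall fun μ => (hBb μ).trans hK₀K,
      Eventually.of_forall fun μ => ⟨(hVb μ).1, (hVb μ).2.trans hK₀K⟩,
      Eventually.of_forall fun μ => ⟨(hDtb μ).1, (hDtb μ).2.trans hK₀K⟩, hΩrm, ?_, ?_, hΩrm', ?_, ?_,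
      ?_, ?_, ?_, ?_, ?_⟩
    · -- balance of the uniform transport
      filter_upwards [hfit] with μ hμ
      obtain ⟨S, e, h0, hsep, he, rfl⟩ := hμ
      exact (hker S e h0 hsep he).1
    · -- covariance of the uniform transport
      filter_upwards [hfit] with μ hμ
      obtain ⟨S, e, h0, hsep, he, rfl⟩ := hμ
      exact fun y hy => (hker S e h0 hsep he).2.1 y ((count_restrict_singleton_ne_zero_iff S y).1 hy)
    · -- balance of the shifted transport
      filter_upwards [hfit] with μ hμ
      obtain ⟨S, e, h0, hsep, he, rfl⟩ := hμ
      exact (hker' S e h0 hsep he).1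
    · -- covariance of the shifted transport
      filter_upwards [hfit] with μ hμ
      obtain ⟨S, e, h0, hsep, he, rfl⟩ := hμ
      exact fun y hy => (hker' S e h0 hsep he).2.1 y ((count_restrict_singleton_ne_zero_iff S y).1 hy)
    · -- identification A
      filter_upwards [hfit] with μ hμ
      obtain ⟨S, e, h0, hsep, he, rfl⟩ := hμ
      obtain ⟨-, -, hnf, hf⟩ := hker S e h0 hsep he
      rw [(hid S e h0 hsep he).1]
      by_cases hFc : FccLike S
      · refine incr_transport_ident_fcc h0 (by rw [hf hFc 0, if_pos rfl])
          (fun y hy => by rw [hf hFc y, if_neg hy]) (fun ν => 2 * rootEnergy lennardJones ν) ?_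
        rw [(lms_functionals_fcc n e he.1 (lms_isFccData_of_fccLike S e hFc he)).1]
        exact (lms_LE_zero_eq S e he).symm
      · refine incr_transport_ident_of_formula (hnf hFc) (fun ν => 2 * rootEnergy lennardJones ν) _
          (fun m i j => lms_rootEnergy_map_sub_pointOf S e he m i j) (fun m => ?_) fun g hg hpts => ?_
        · have h := ((hAB n e he.1).1 m).trans hK₁K
          rw [abs_le] at h
          linarith
        · simp only [hw]
          exact lms_ident_A n S e he g K hg hpts
    · -- identification B
      filter_upwards [hfit] with μ hμ
      obtain ⟨S, e, h0, hsep, he, rfl⟩ := hμ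
      obtain ⟨-, -, hnf, hf⟩ := hker' S e h0 hsep he
      rw [(hid S e h0 hsep he).2.1]
      by_cases hFc : FccLike S
      · refine incr_transport_ident_fcc h0 (by rw [hf hFc 0, if_pos rfl])
          (fun y hy => by rw [hf hFc y, if_neg hy]) (fun ν => 2 * rootEnergy lennardJones ν) ?_
        rw [(lms_functionals_fcc n e he.1 (lms_isFccData_of_fccLike S e hFc he)).2.1]
        exact (lms_LE_zero_eq S e he).symm
      · refine incr_transport_ident_of_formula (hnf hFc) (fun ν => 2 * rootEnergy lennardJones ν) _
          (fun m i j => lms_rootEnergy_map_sub_pointOf S e he m i j) (fun m => ?_)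
          fun g hg hpts => lms_ident_B n S e he g K hg hpts
        have h := ((hAB n e he.1).1 m).trans hK₁K
        rw [abs_le] at h
        linarith
    · -- identification D
      filter_upwards [hfit] with μ hμ
      obtain ⟨S, e, h0, hsep, he, rfl⟩ := hμ
      obtain ⟨-, -, hnf, hf⟩ := hker S e h0 hsep he
      rw [(hid S e h0 hsep he).2.2.2]
      by_cases hFc : FccLike S
      · refine incr_transport_ident_fcc h0 (by rw [hf hFc 0, if_pos rfl])
          (fun y hy => by rw [hf hFc y, if_neg hy]) D ?_
        have hfcc := lms_functionals_fcc n e he.1 (lms_isFccData_of_fccLike S e hFc he)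
        rw [hDid S e h0 hsep he, hfcc.2.2.2.2]
        exact hfcc.2.2.2.1.symm
      · refine incr_transport_ident_of_formula (hnf hFc) D _
          (fun m i j => lms_D_map_sub_pointOf δ D hDid S e h0 hsep he m i j)
          (fun m => add_nonneg (by positivity) hKpos) fun g hg hpts => ?_
        simp only [hw]
        exact lms_ident_D n S e he g K hg hpts
    · -- convexity
      filter_upwards [hfit, hFF] with μ hμ hff
      obtain ⟨S, e, h0, hsep, he, rfl⟩ := hμ
      obtain ⟨hA, hB, hV, -⟩ := hid S e h0 hsep he
      rw [hA, hB, hV]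
      exact incr_convexity_mono (le_max_left Cc 1) n (hconv n e he.1 (hff S e rfl h0 hsep he))
    · -- the edge bound `Dt ≤ 2V + C/(2n+1)`
      filter_upwards [hfit] with μ hμ
      obtain ⟨S, e, h0, hsep, he, rfl⟩ := hμ
      obtain ⟨-, -, hV, hDt⟩ := hid S e h0 hsep he
      rw [hV, hDt]
      have h1 := lms_Dt_le n e he.1
      have h2 : 1 / (2 * (n : ℝ) + 1) ≤ max Cc 1 / (2 * (n : ℝ) + 1) :=
        div_le_div_of_nonneg_right (le_max_right Cc 1) (by positivity)
      linarith
  -- Step 2: root-to-everywhere, evaluated at the pattern points of every layer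
  have hlf : ∀ᵐ μ ∂P, ∀ k : ℕ, μ ((fun z : E3 => ⌊‖z‖⌋₊) ⁻¹' {k}) < ⊤ := by
    filter_upwards [hcore] with μ hc k
    obtain ⟨S, -, hsep, rfl⟩ := hc
    exact PalmUnimodularRigidity.count_restrict_floorNorm_preimage_lt_top hδ hsep k
  have hD0' := PalmUnimodularRigidity.ae_forall_map_sub_of_ae hlaw.2.1 hlf hD0
  filter_upwards [hD0'] with μ hμ
  intro S e hμS h0 hsep he
  subst hμS
  refine incr_heights_linear he.1.2.2 fun m => ?_
  have hy : pointOf e m 0 0 ∈ S := by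
    rw [← he.2]
    exact ⟨m, 0, 0, rfl⟩
  have h1 := hμ (pointOf e m 0 0) ((count_restrict_singleton_ne_zero_iff S _).2 hy)
  rwa [lms_D_map_sub_pointOf δ D hDid S e h0 hsep he m 0 0] at h1

end Summit.AtomisticToContinuum.Crystallization.Theorems.SlackRigidityPricedFloorsFinal

end
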